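import Summits.QuantumFields.BalabanUV.Beta.CovariantLaplacianFlatSplit
import Summits.QuantumFields.BalabanUV.Beta.MultiscaleRemainderLapTorus

/-!
# `Summit.QuantumFields.BalabanUV.Beta.CovariantFluxTorus` — THE NET FLUX `M_R(x)` OF `R − 1` ON THE TORUS IN PRINT'S TWO-CONDITION FORM:
# `M_R(x) = c₀²·Σ_μ [(R_{x−e_μ,μ} − R_{x,μ}) − (R_{x,μ} − 1)ᵀ(R_{x,μ} − 1)]`, hence `‖M_R(x)‖ ≤ c₀²·d·(γ + ε²)` from the DEVIATION
# `‖R_b − 1‖ ≤ ε` and the LATTICE GRADIENT `‖R_{x−e_μ,μ} − R_{x,μ}‖ ≤ γ` of the transporters (module 3b of road P3's reduction «rough-`Rm`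
# gradient member ⇐ flat interior estimate (FG) + sup member + ONE (3.35)-shaped binder (SF)», claim «COVARIANT-FLAT-SPLIT»)

HONEST FRAMING (page 1 of everything in this cell).  Discharging `FlowStep.BetaPertH` would make Bałaban's ultraviolet
stability UNCONDITIONAL — a constructive-QFT result; it is NOT the continuum limit and NOT the Clay problem.  This module
discharges nothing of `BetaPertH`; it is [folklore] finite-dimensional algebra on the torus MODEL, kernel-checked, by CO-OWNER #3 of binder row
D4 (unit `b2b-balaban-beta-d4-p3`, road P3 «reduction road», gen 13).  HONEST DEPENDENCY: continuum YM on T⁴ ⇐ BetaPertH ∧ nine spine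
estimates (0/9 proved); BetaPertH ⇐ (D1) ∧ (D4) ∧ CAP+tail; G-an2-4 gates asym, D1 and NE2/3/4.

THE POINT.  Module 1 (`CovariantLaplacianFlatSplit`) isolates the ZEROTH-order part of `D_R*D_R − D_1*D_1` as the net flux
`M_R(x) = Σ_{b : tgt b = x} c_b²(R_b − 1) + Σ_{b : src b = x} c_b²(R_bᵀ − 1)` and takes `‖M_R(x)v‖ ≤ ε_M‖v‖` as a datum.  Bounding it
termwise by the deviations `‖R_b − 1‖ ≤ ε` would give `ε_M ≲ 2d·c₀²·ε` — ONE POWER OF THE SCALE TOO WEAK for the gradient member (`ε ≍ σ₁/scale`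
while the member needs `ε_M ≍ 1/scale²`).  The cancellation is the lattice divergence: on the unit torus `UT N` with bonds `(y, μ) : y → y + e_μ`
and a constant weight `c ≡ c₀`,
* §1 `dir_identity` — per direction, for column-orthonormal `R` (outgoing) and any `R′` (incoming):
  `(R′ − 1)v + (Rᵀ − 1)v = (R′ − R)v − (R − 1)ᵀ((R − 1)v)` (`Rᵀ − 1 = −(R − 1) − (R − 1)ᵀ(R − 1)` for `RᵀR = 1`);
  `norm_dir_le` — `‖(R′ − 1)v + (Rᵀ − 1)v‖ ≤ (γ + ε²)‖v‖` from `‖(R′ − R)v‖ ≤ γ‖v‖`, `‖(R − 1)v‖ ≤ ε‖v‖`;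
* §2 **`flux_torus_apply`** — `(M_R(x)v)_i = c₀²·Σ_μ [((R_{(x−e_μ,μ)} − 1)v)_i + ((R_{(x,μ)}ᵀ − 1)v)_i]` (bonds into `x` start at `x − e_μ`);
  **`norm_flux_torus_le`** — THE (SF) DICTIONARY: if at the site `x`, for every direction `μ`, `‖(R_{(x,μ)} − 1)v‖ ≤ ε‖v‖` and
  `‖(R_{(x−e_μ,μ)} − R_{(x,μ)})v‖ ≤ γ‖v‖` for all `v`, then **`‖M_R(x)v‖ ≤ c₀²·d·(γ + ε²)·‖v‖`** — so module 1's flux datum `ε_M` may be fed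
  from print's TWO conditions in a gauge: the deviation (`|A| ≲ σ₁/scale` ⟶ `ε`) and the lattice gradient of the transporters
  (`|∇A| ≲ σ₂/scale²` ⟶ `γ`), giving `ε_M ≤ c₀²d(σ₂ + σ₁²)/scale²` — the right power.
Generic in `d`; constant weight only (the MODEL's case).

LOCATORS (shape only, nothing printed asserted; ABSOLUTE RULE): [Balaban1985BackgroundPropagators] (3.35) p. 396 («|A| < O(1)Mα₀(L^jη)^{−1},
|∇^η A| < O(1)Mα₀(L^jη)^{−2} on □»), (3.23) p. 394.  Row D4: NO class change (critical-path width 0; D4 DISCHARGE NO DATE); NOT BetaPertH, NOT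
continuum, NOT Clay, NOT summit progress.
-/

open scoped BigOperators
open Finset

namespace Summit.QuantumFields.BalabanUV.Beta.CovariantFluxTorus

open Literature.MathematicalPhysics.QuantumFieldTheory.Balaban1983to89
open Literature.MathematicalPhysics.QuantumFieldTheory.Balaban1983to89.B9Thm37GluePU (bsrc btgt bsrc_apply btgt_apply)
open B5TorusCover (UT)
open B5Leibniz121 (up dn)
open Summit.QuantumFields.BalabanUV.Beta.CovariantKato (sqrt_sum_sq_add_le sqrt_sum_sq_sum_le sqrt_sum_sq_smul)
open Summit.QuantumFields.BalabanUV.Beta.CovariantLaplacianFlatSplit (sum_sub_delta_mul sum_sub_delta_mul' sumT_sub_delta_eq_neg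
  normT_sub_delta_le)
open Summit.QuantumFields.BalabanUV.Beta.MultiscaleRemainderLapTorus (sum_ite_bsrc_eq sum_ite_btgt_eq)

noncomputable section

/-! ## §1 One direction: `(R′ − 1) + (Rᵀ − 1) = (R′ − R) − (R − 1)ᵀ(R − 1)` -/

section Dir

variable {Cp : Type} [Fintype Cp] [DecidableEq Cp]

/-- **Per direction**: for column-orthonormal `R` and any `R′`,
`Σ_j (R′_{ij} − δ_{ij})v_j + Σ_k (R_{ki} − δ_{ki})v_k = Σ_j (R′_{ij} − R_{ij})v_j − Σ_k (R_{ki} − δ_{ki})·(Σ_j (R_{kj} − δ_{kj})v_j)`. [folklore] -/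
theorem dir_identity (R R' : Cp → Cp → ℝ) (hR : ∀ i j, ∑ k, R k i * R k j = if i = j then (1 : ℝ) else 0) (v : Cp → ℝ) (i : Cp) :
    (∑ j, (R' i j - if i = j then (1 : ℝ) else 0) * v j) + ∑ k, (R k i - if k = i then (1 : ℝ) else 0) * v k =
      (∑ j, (R' i j - R i j) * v j) -
        ∑ k, (R k i - if k = i then (1 : ℝ) else 0) * ∑ j, (R k j - if k = j then (1 : ℝ) else 0) * v j := by
  rw [sumT_sub_delta_eq_neg R hR v i,
    sum_sub_delta_mul R (fun k => ∑ j, (R k j - if k = j then (1 : ℝ) else 0) * v j) i,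
    sum_sub_delta_mul' R' v i, sum_sub_delta_mul' R v i]
  have e : ∑ j, (R' i j - R i j) * v j = ∑ j, R' i j * v j - ∑ j, R i j * v j := by
    rw [← Finset.sum_sub_distrib]; exact Finset.sum_congr rfl fun j _ => by ring
  rw [e]
  ring

/-- **Per direction, in norm**: `‖(R′ − 1)v + (Rᵀ − 1)v‖ ≤ (γ + ε²)·‖v‖` from `‖(R′ − R)v‖ ≤ γ‖v‖` and `‖(R − 1)v‖ ≤ ε‖v‖` (`ε ≥ 0`).
[folklore] -/
theorem norm_dir_le (R R' : Cp → Cp → ℝ) (hR : ∀ i j, ∑ k, R k i * R k j = if i = j then (1 : ℝ) else 0) {ε γ : ℝ} (hε0 : 0 ≤ ε)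
    (hε : ∀ v : Cp → ℝ, Real.sqrt (∑ i, (∑ j, (R i j - if i = j then (1 : ℝ) else 0) * v j) ^ 2) ≤ ε * Real.sqrt (∑ j, v j ^ 2))
    (hγ : ∀ v : Cp → ℝ, Real.sqrt (∑ i, (∑ j, (R' i j - R i j) * v j) ^ 2) ≤ γ * Real.sqrt (∑ j, v j ^ 2)) (v : Cp → ℝ) :
    Real.sqrt (∑ i, ((∑ j, (R' i j - if i = j then (1 : ℝ) else 0) * v j) + ∑ k, (R k i - if k = i then (1 : ℝ) else 0) * v k) ^ 2) ≤
      (γ + ε ^ 2) * Real.sqrt (∑ j, v j ^ 2) := by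
  set w : Cp → ℝ := fun k => ∑ j, (R k j - if k = j then (1 : ℝ) else 0) * v j with hw
  have hid : ∀ i, (∑ j, (R' i j - if i = j then (1 : ℝ) else 0) * v j) + ∑ k, (R k i - if k = i then (1 : ℝ) else 0) * v k =
      (∑ j, (R' i j - R i j) * v j) + -(∑ k, (R k i - if k = i then (1 : ℝ) else 0) * w k) := fun i => by
    rw [dir_identity R R' hR v i, sub_eq_add_neg]
  simp only [hid]
  have h1 := sqrt_sum_sq_add_le (fun i => ∑ j, (R' i j - R i j) * v j) (fun i => -(∑ k, (R k i - if k = i then (1 : ℝ) else 0) * w k))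
  refine h1.trans ?_
  have hneg : Real.sqrt (∑ i, (-(∑ k, (R k i - if k = i then (1 : ℝ) else 0) * w k)) ^ 2) =
      Real.sqrt (∑ i, (∑ k, (R k i - if k = i then (1 : ℝ) else 0) * w k) ^ 2) := by
    congr 1; exact Finset.sum_congr rfl fun i _ => by rw [neg_sq]
  rw [hneg]
  have hw_le : Real.sqrt (∑ k, w k ^ 2) ≤ ε * Real.sqrt (∑ j, v j ^ 2) := hε v
  have hT := normT_sub_delta_le R hR hε w
  have hv0 : 0 ≤ Real.sqrt (∑ j, v j ^ 2) := Real.sqrt_nonneg _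
  calc Real.sqrt (∑ i, (∑ j, (R' i j - R i j) * v j) ^ 2) + Real.sqrt (∑ i, (∑ k, (R k i - if k = i then (1 : ℝ) else 0) * w k) ^ 2)
      ≤ γ * Real.sqrt (∑ j, v j ^ 2) + ε * Real.sqrt (∑ k, w k ^ 2) := add_le_add (hγ v) hT
    _ ≤ γ * Real.sqrt (∑ j, v j ^ 2) + ε * (ε * Real.sqrt (∑ j, v j ^ 2)) := add_le_add le_rfl (mul_le_mul_of_nonneg_left hw_le hε0)
    _ = (γ + ε ^ 2) * Real.sqrt (∑ j, v j ^ 2) := by ring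

end Dir

/-! ## §2 The flux at a torus site -/

section Torus

variable {d : ℕ} {N : Fin d → ℕ} [∀ i, NeZero (N i)] {Cp : Type} [Fintype Cp] [DecidableEq Cp]

/-- **The flux at a torus site, direction by direction**: for `c ≡ c₀`,
`Σ_{b : btgt b = x} c_b²·((R_b − 1)v)_i + Σ_{b : bsrc b = x} c_b²·((R_bᵀ − 1)v)_i = c₀²·Σ_μ [((R_{(x−e_μ,μ)} − 1)v)_i + ((R_{(x,μ)}ᵀ − 1)v)_i]`.
[folklore] -/
theorem flux_torus_apply {c : UT N × Fin d → ℝ} {c₀ : ℝ} (hc : ∀ b, c b = c₀) (Rm : UT N × Fin d → Cp → Cp → ℝ)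
    (x : UT N) (v : Cp → ℝ) (i : Cp) :
    (∑ b ∈ univ.filter (fun b : UT N × Fin d => btgt b = x), c b ^ 2 * ∑ j, (Rm b i j - if i = j then (1 : ℝ) else 0) * v j)
      + ∑ b ∈ univ.filter (fun b : UT N × Fin d => bsrc b = x), c b ^ 2 * ∑ k, (Rm b k i - if k = i then (1 : ℝ) else 0) * v k =
      c₀ ^ 2 * ∑ μ, ((∑ j, (Rm (dn x μ, μ) i j - if i = j then (1 : ℝ) else 0) * v j)
        + ∑ k, (Rm (x, μ) k i - if k = i then (1 : ℝ) else 0) * v k) := by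
  classical
  rw [Finset.sum_filter, Finset.sum_filter,
    sum_ite_btgt_eq x (fun b => c b ^ 2 * ∑ j, (Rm b i j - if i = j then (1 : ℝ) else 0) * v j),
    sum_ite_bsrc_eq x (fun b => c b ^ 2 * ∑ k, (Rm b k i - if k = i then (1 : ℝ) else 0) * v k),
    ← Finset.sum_add_distrib, Finset.mul_sum]
  refine Finset.sum_congr rfl fun μ _ => ?_
  rw [hc, hc]
  ring

/-- **THE (SF) DICTIONARY FOR THE FLUX: `‖M_R(x)v‖ ≤ c₀²·d·(γ + ε²)·‖v‖`.**  Unit torus, constant weight `c ≡ c₀`, column-orthonormal bond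
matrices; at the site `x`, for every direction `μ` and every `v`: `‖(R_{(x,μ)} − 1)v‖ ≤ ε‖v‖` (deviation of the OUTGOING transporters, `ε ≥ 0`)
and `‖(R_{(x−e_μ,μ)} − R_{(x,μ)})v‖ ≤ γ‖v‖` (lattice gradient of the transporter along its own direction).  Then the flux datum of
`CovariantLaplacianFlatSplit.norm_covLap_sub_flat_le` holds with `ε_M = c₀²·d·(γ + ε²)`. [cite: Balaban1985BackgroundPropagators, (3.35) p.396]
[folklore] -/
theorem norm_flux_torus_le {c : UT N × Fin d → ℝ} {c₀ : ℝ} (hc : ∀ b, c b = c₀) (Rm : UT N × Fin d → Cp → Cp → ℝ)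
    (hRm : ∀ b i j, ∑ k, Rm b k i * Rm b k j = if i = j then (1 : ℝ) else 0) (x : UT N) {ε γ : ℝ} (hε0 : 0 ≤ ε)
    (hε : ∀ μ (v : Cp → ℝ), Real.sqrt (∑ i, (∑ j, (Rm (x, μ) i j - if i = j then (1 : ℝ) else 0) * v j) ^ 2) ≤ ε * Real.sqrt (∑ j, v j ^ 2))
    (hγ : ∀ μ (v : Cp → ℝ), Real.sqrt (∑ i, (∑ j, (Rm (dn x μ, μ) i j - Rm (x, μ) i j) * v j) ^ 2) ≤ γ * Real.sqrt (∑ j, v j ^ 2))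
    (v : Cp → ℝ) :
    Real.sqrt (∑ i, ((∑ b ∈ univ.filter (fun b : UT N × Fin d => btgt b = x), c b ^ 2 * ∑ j, (Rm b i j - if i = j then (1 : ℝ) else 0) * v j)
      + ∑ b ∈ univ.filter (fun b : UT N × Fin d => bsrc b = x), c b ^ 2 * ∑ k, (Rm b k i - if k = i then (1 : ℝ) else 0) * v k) ^ 2) ≤
      c₀ ^ 2 * d * (γ + ε ^ 2) * Real.sqrt (∑ j, v j ^ 2) := by
  classical
  have happ : ∀ i, (∑ b ∈ univ.filter (fun b : UT N × Fin d => btgt b = x), c b ^ 2 * ∑ j, (Rm b i j - if i = j then (1 : ℝ) else 0) * v j)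
      + ∑ b ∈ univ.filter (fun b : UT N × Fin d => bsrc b = x), c b ^ 2 * ∑ k, (Rm b k i - if k = i then (1 : ℝ) else 0) * v k =
      c₀ ^ 2 * ∑ μ, ((∑ j, (Rm (dn x μ, μ) i j - if i = j then (1 : ℝ) else 0) * v j)
        + ∑ k, (Rm (x, μ) k i - if k = i then (1 : ℝ) else 0) * v k) := fun i => flux_torus_apply hc Rm x v i
  simp only [happ]
  rw [sqrt_sum_sq_smul, abs_of_nonneg (sq_nonneg c₀)]
  have hsum := sqrt_sum_sq_sum_le (Finset.univ : Finset (Fin d))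
    (fun μ i => (∑ j, (Rm (dn x μ, μ) i j - if i = j then (1 : ℝ) else 0) * v j) + ∑ k, (Rm (x, μ) k i - if k = i then (1 : ℝ) else 0) * v k)
  have hdir : ∀ μ, Real.sqrt (∑ i, ((∑ j, (Rm (dn x μ, μ) i j - if i = j then (1 : ℝ) else 0) * v j)
      + ∑ k, (Rm (x, μ) k i - if k = i then (1 : ℝ) else 0) * v k) ^ 2) ≤ (γ + ε ^ 2) * Real.sqrt (∑ j, v j ^ 2) :=
    fun μ => norm_dir_le (Rm (x, μ)) (Rm (dn x μ, μ)) (hRm (x, μ)) hε0 (hε μ) (hγ μ) v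
  calc c₀ ^ 2 * Real.sqrt (∑ i, (∑ μ, ((∑ j, (Rm (dn x μ, μ) i j - if i = j then (1 : ℝ) else 0) * v j)
          + ∑ k, (Rm (x, μ) k i - if k = i then (1 : ℝ) else 0) * v k)) ^ 2)
      ≤ c₀ ^ 2 * ∑ μ : Fin d, (γ + ε ^ 2) * Real.sqrt (∑ j, v j ^ 2) :=
        mul_le_mul_of_nonneg_left (hsum.trans (Finset.sum_le_sum fun μ _ => hdir μ)) (sq_nonneg c₀)
    _ = c₀ ^ 2 * d * (γ + ε ^ 2) * Real.sqrt (∑ j, v j ^ 2) := by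
        rw [Finset.sum_const, Finset.card_univ, Fintype.card_fin, nsmul_eq_mul]; ring

end Torus

end

end Summit.QuantumFields.BalabanUV.Beta.CovariantFluxTorus
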